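import Summits.CriticalPhenomena.PercolationContinuityZ3.Theorems.PercNearOneGluingNoHeavyLowerTailForestRayleighContract
import Summits.CriticalPhenomena.PercolationContinuityZ3.Theorems.PercNearOneGluingNoHeavyLowerTailForestRayleighKFour
import HarnessLib

/-!
# Weighted forest negative correlation — contraction II: the reduction steps at a pinned edge `uv`

Notation as in `…ForestRayleighTools`; `(R)(D;K;e,f)` the Rayleigh inequality. Throughout `uv ∈ K`
is pinned and `x` is a third vertex; `g = vx`, `g' = ux` (parallel in the contraction `E/uv`).
Each lemma derives `(R)` for an instance from `(R)` for the instance with one edge at `v` fewer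
(or moved to `u`), possibly with modified activities:

* `lsm_free_closing` (a free edge closing a pinned cycle is deleted),
* `lsm_pin_reroute` (`g ∈ K`, `g'` fresh: pin `g'` instead),
* `lsm_free_reroute` (`g ∈ D`, `g'` fresh: free `g'` with `w(g)` instead),
* `lsm_free_merge` (`g, g' ∈ D`: one free `g'` with `w(g) + w(g')`),
* `lsm_rayleigh_reroute` (`g = e`, `g'` fresh: Rayleigh edge `g'` instead),
* `lsm_pin_pendant_base` (only `uv` is left at `v`: drop it; the instance then lives in a system
  avoiding `v`).

These are the cases of the contraction theorem `…ForestRayleighContractMain`. Theorems only; no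
definitions, no `sorry`.
-/

open Finset SimpleGraph
open scoped Classical

namespace Summit.CriticalPhenomena.PercolationContinuityZ3.Theorems.ForestRayleigh

variable {V : Type*} [Fintype V] [DecidableEq V]

omit [Fintype V] in
/-- **Deleting a free edge that closes a pinned cycle.** If `g ∉ D` and `⟨K ∪ g⟩` is not acyclic,
`(R)(D;K;e,f)` gives `(R)(D ∪ g;K;e,f)` (all four partition functions are unchanged). [elementary] -/
theorem lsm_free_closing (w : Sym2 V → ℝ) (D K : Finset (Sym2 V)) (e f g : Sym2 V) (hg : g ∉ D)
    (hK : ¬(fromEdgeSet ((insert g K : Finset (Sym2 V)) : Set (Sym2 V))).IsAcyclic)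
    (h :
    (∑ G ∈ D.powerset.filter (fun G =>
        (fromEdgeSet ((G ∪ (insert e (insert f (K))) : Finset (Sym2 V)) : Set (Sym2 V))).IsAcyclic), ∏ y ∈ G, w y) *
      (∑ G ∈ D.powerset.filter (fun G =>
        (fromEdgeSet ((G ∪ (K) : Finset (Sym2 V)) : Set (Sym2 V))).IsAcyclic), ∏ y ∈ G, w y) ≤
    (∑ G ∈ D.powerset.filter (fun G =>
        (fromEdgeSet ((G ∪ (insert e (K)) : Finset (Sym2 V)) : Set (Sym2 V))).IsAcyclic), ∏ y ∈ G, w y) *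
      (∑ G ∈ D.powerset.filter (fun G =>
        (fromEdgeSet ((G ∪ (insert f (K)) : Finset (Sym2 V)) : Set (Sym2 V))).IsAcyclic), ∏ y ∈ G, w y)) :
    (∑ G ∈ (insert g D).powerset.filter (fun G =>
        (fromEdgeSet ((G ∪ (insert e (insert f (K))) : Finset (Sym2 V)) : Set (Sym2 V))).IsAcyclic), ∏ y ∈ G, w y) *
      (∑ G ∈ (insert g D).powerset.filter (fun G =>
        (fromEdgeSet ((G ∪ (K) : Finset (Sym2 V)) : Set (Sym2 V))).IsAcyclic), ∏ y ∈ G, w y) ≤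
    (∑ G ∈ (insert g D).powerset.filter (fun G =>
        (fromEdgeSet ((G ∪ (insert e (K)) : Finset (Sym2 V)) : Set (Sym2 V))).IsAcyclic), ∏ y ∈ G, w y) *
      (∑ G ∈ (insert g D).powerset.filter (fun G =>
        (fromEdgeSet ((G ∪ (insert f (K)) : Finset (Sym2 V)) : Set (Sym2 V))).IsAcyclic), ∏ y ∈ G, w y) := by
  have hmono : ∀ K' : Finset (Sym2 V), K ⊆ K' →
      ¬(fromEdgeSet ((insert g K' : Finset (Sym2 V)) : Set (Sym2 V))).IsAcyclic :=
    fun K' hKK' hA => hK (isAcyclic_of_subset (Finset.insert_subset_insert g hKK') hA)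
  rw [forestsW_free_closing w D _ hg (hmono _ (by intro z hz; simp [hz])),
    forestsW_free_closing w D _ hg hK,
    forestsW_free_closing w D _ hg (hmono _ (Finset.subset_insert _ _)),
    forestsW_free_closing w D _ hg (hmono _ (Finset.subset_insert _ _))]
  exact h

/-- **Re-routing a pinned edge through the pinned edge `uv`.** With `uv ∈ K₁`, `g = vx`, `g' = ux`,
both outside `D ∪ K₁ ∪ {e,f}` (`x ≠ u, v`): `(R)(D;K₁ ∪ g';e,f)` gives `(R)(D;K₁ ∪ g;e,f)`.
[elementary; `forestsW_pin_reroute`] -/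
theorem lsm_pin_reroute (w : Sym2 V → ℝ) (D K₁ : Finset (Sym2 V)) (e f : Sym2 V) {u v x : V}
    (hDK : ∀ z ∈ D ∪ insert e (insert f K₁), ¬z.IsDiag) (huv : s(v, u) ∈ K₁) (hvx : v ≠ x)
    (hux : u ≠ x) (h₁ : s(v, x) ∉ D ∪ insert e (insert f K₁)) (h₂ : s(u, x) ∉ D ∪ insert e (insert f K₁))
    (h :
    (∑ G ∈ D.powerset.filter (fun G =>
        (fromEdgeSet ((G ∪ (insert e (insert f (insert s(u, x) K₁))) : Finset (Sym2 V)) : Set (Sym2 V))).IsAcyclic), ∏ y ∈ G, w y) *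
      (∑ G ∈ D.powerset.filter (fun G =>
        (fromEdgeSet ((G ∪ ((insert s(u, x) K₁)) : Finset (Sym2 V)) : Set (Sym2 V))).IsAcyclic), ∏ y ∈ G, w y) ≤
    (∑ G ∈ D.powerset.filter (fun G =>
        (fromEdgeSet ((G ∪ (insert e (insert s(u, x) K₁)) : Finset (Sym2 V)) : Set (Sym2 V))).IsAcyclic), ∏ y ∈ G, w y) *
      (∑ G ∈ D.powerset.filter (fun G =>
        (fromEdgeSet ((G ∪ (insert f (insert s(u, x) K₁)) : Finset (Sym2 V)) : Set (Sym2 V))).IsAcyclic), ∏ y ∈ G, w y)) :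
    (∑ G ∈ D.powerset.filter (fun G =>
        (fromEdgeSet ((G ∪ (insert e (insert f (insert s(v, x) K₁))) : Finset (Sym2 V)) : Set (Sym2 V))).IsAcyclic), ∏ y ∈ G, w y) *
      (∑ G ∈ D.powerset.filter (fun G =>
        (fromEdgeSet ((G ∪ ((insert s(v, x) K₁)) : Finset (Sym2 V)) : Set (Sym2 V))).IsAcyclic), ∏ y ∈ G, w y) ≤
    (∑ G ∈ D.powerset.filter (fun G =>
        (fromEdgeSet ((G ∪ (insert e (insert s(v, x) K₁)) : Finset (Sym2 V)) : Set (Sym2 V))).IsAcyclic), ∏ y ∈ G, w y) *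
      (∑ G ∈ D.powerset.filter (fun G =>
        (fromEdgeSet ((G ∪ (insert f (insert s(v, x) K₁)) : Finset (Sym2 V)) : Set (Sym2 V))).IsAcyclic), ∏ y ∈ G, w y) := by
  -- `Z(D; X ∪ (K₁ ∪ vx)) = Z(D; X ∪ (K₁ ∪ ux))` for the four pinned sets `X`
  have key : ∀ X : Finset (Sym2 V), X ⊆ insert e (insert f ∅) →
      (∑ G ∈ D.powerset.filter (fun G =>
        (fromEdgeSet ((G ∪ (X ∪ insert s(v, x) K₁) : Finset (Sym2 V)) : Set (Sym2 V))).IsAcyclic), ∏ y ∈ G, w y) =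
      (∑ G ∈ D.powerset.filter (fun G =>
        (fromEdgeSet ((G ∪ (X ∪ insert s(u, x) K₁) : Finset (Sym2 V)) : Set (Sym2 V))).IsAcyclic), ∏ y ∈ G, w y) := by
    intro X hX
    have hXK : X ∪ K₁ ⊆ insert e (insert f K₁) := by
      intro z hz
      rcases Finset.mem_union.1 hz with hz | hz
      · have := hX hz; simp only [Finset.mem_insert, Finset.notMem_empty, or_false] at this
        rcases this with rfl | rfl <;> simp
      · simp [hz]
    have hsub : D ∪ (X ∪ K₁) ⊆ D ∪ insert e (insert f K₁) :=
      Finset.union_subset_union subset_rfl hXK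
    rw [Finset.union_insert, Finset.union_insert]
    exact forestsW_pin_reroute w D (X ∪ K₁) (fun z hz => hDK z (hsub hz))
      (Finset.mem_union_right _ huv) hvx hux (fun hh => h₁ (hsub hh)) (fun hh => h₂ (hsub hh))
  have k₁ := key (insert e (insert f ∅)) subset_rfl
  have k₂ := key ∅ (Finset.empty_subset _)
  have k₃ := key (insert e ∅) (Finset.insert_subset_insert e (Finset.empty_subset _))
  have k₄ := key (insert f ∅) (by intro z hz; simp only [Finset.mem_insert, Finset.notMem_empty, or_false] at hz; subst hz; simp)
  simp only [Finset.insert_union, Finset.empty_union] at k₁ k₂ k₃ k₄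
  rw [k₁, k₂, k₃, k₄]
  exact h

/-- **Re-routing a free edge through the pinned edge `uv`.** With `uv ∈ K`, `g = vx`, `g' = ux`
outside `D₁ ∪ K ∪ {e,f}` (`x ≠ u, v`) and `w' = w[g' ↦ w(g)]`: `(R)_{w'}(D₁ ∪ g';K;e,f)` gives
`(R)_w(D₁ ∪ g;K;e,f)`. [elementary; `forestsW_free_reroute`] -/
theorem lsm_free_reroute (w : Sym2 V → ℝ) (D₁ K : Finset (Sym2 V)) (e f : Sym2 V) {u v x : V}
    (hDK : ∀ z ∈ D₁ ∪ insert e (insert f K), ¬z.IsDiag) (huv : s(v, u) ∈ K) (hvx : v ≠ x)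
    (hux : u ≠ x) (h₁ : s(v, x) ∉ D₁ ∪ insert e (insert f K)) (h₂ : s(u, x) ∉ D₁ ∪ insert e (insert f K))
    (h :
    (∑ G ∈ (insert s(u, x) D₁).powerset.filter (fun G =>
        (fromEdgeSet ((G ∪ (insert e (insert f (K))) : Finset (Sym2 V)) : Set (Sym2 V))).IsAcyclic), ∏ y ∈ G, Function.update w s(u, x) (w s(v, x)) y) *
      (∑ G ∈ (insert s(u, x) D₁).powerset.filter (fun G =>
        (fromEdgeSet ((G ∪ (K) : Finset (Sym2 V)) : Set (Sym2 V))).IsAcyclic), ∏ y ∈ G, Function.update w s(u, x) (w s(v, x)) y) ≤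
    (∑ G ∈ (insert s(u, x) D₁).powerset.filter (fun G =>
        (fromEdgeSet ((G ∪ (insert e (K)) : Finset (Sym2 V)) : Set (Sym2 V))).IsAcyclic), ∏ y ∈ G, Function.update w s(u, x) (w s(v, x)) y) *
      (∑ G ∈ (insert s(u, x) D₁).powerset.filter (fun G =>
        (fromEdgeSet ((G ∪ (insert f (K)) : Finset (Sym2 V)) : Set (Sym2 V))).IsAcyclic), ∏ y ∈ G, Function.update w s(u, x) (w s(v, x)) y)) :
    (∑ G ∈ (insert s(v, x) D₁).powerset.filter (fun G =>
        (fromEdgeSet ((G ∪ (insert e (insert f (K))) : Finset (Sym2 V)) : Set (Sym2 V))).IsAcyclic), ∏ y ∈ G, w y) *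
      (∑ G ∈ (insert s(v, x) D₁).powerset.filter (fun G =>
        (fromEdgeSet ((G ∪ (K) : Finset (Sym2 V)) : Set (Sym2 V))).IsAcyclic), ∏ y ∈ G, w y) ≤
    (∑ G ∈ (insert s(v, x) D₁).powerset.filter (fun G =>
        (fromEdgeSet ((G ∪ (insert e (K)) : Finset (Sym2 V)) : Set (Sym2 V))).IsAcyclic), ∏ y ∈ G, w y) *
      (∑ G ∈ (insert s(v, x) D₁).powerset.filter (fun G =>
        (fromEdgeSet ((G ∪ (insert f (K)) : Finset (Sym2 V)) : Set (Sym2 V))).IsAcyclic), ∏ y ∈ G, w y) := by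
  have key : ∀ X : Finset (Sym2 V), X ⊆ insert e (insert f K) → K ⊆ X →
      (∑ G ∈ (insert s(v, x) D₁).powerset.filter (fun G =>
        (fromEdgeSet ((G ∪ X : Finset (Sym2 V)) : Set (Sym2 V))).IsAcyclic), ∏ y ∈ G, w y) =
      (∑ G ∈ (insert s(u, x) D₁).powerset.filter (fun G =>
        (fromEdgeSet ((G ∪ X : Finset (Sym2 V)) : Set (Sym2 V))).IsAcyclic),
        ∏ y ∈ G, Function.update w s(u, x) (w s(v, x)) y) := by
    intro X hX hKX
    have hsub : D₁ ∪ X ⊆ D₁ ∪ insert e (insert f K) := Finset.union_subset_union subset_rfl hX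
    exact forestsW_free_reroute w D₁ X (fun z hz => hDK z (hsub hz)) (hKX huv) hvx hux
      (fun hh => h₁ (hsub hh)) (fun hh => h₂ (hsub hh))
  rw [key _ subset_rfl (by intro z hz; simp [hz]),
    key K ((Finset.subset_insert _ _).trans (Finset.subset_insert _ _)) subset_rfl,
    key (insert e K) (Finset.insert_subset_insert e (Finset.subset_insert _ _)) (Finset.subset_insert _ _),
    key (insert f K) (Finset.subset_insert _ _) (Finset.subset_insert _ _)]
  exact h

/-- **Merging two free parallel edges through the pinned edge `uv`.** With `uv ∈ K`, `g = vx`,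
`g' = ux` outside `D₂ ∪ K ∪ {e,f}` (`x ≠ u, v`) and `w' = w[g' ↦ w(g') + w(g)]`:
`(R)_{w'}(D₂ ∪ g';K;e,f)` gives `(R)_w(D₂ ∪ {g,g'};K;e,f)`. [S–W Prop. 3.7, parallel case] -/
theorem lsm_free_merge (w : Sym2 V → ℝ) (D₂ K : Finset (Sym2 V)) (e f : Sym2 V) {u v x : V}
    (hDK : ∀ z ∈ D₂ ∪ insert e (insert f K), ¬z.IsDiag) (huv : s(v, u) ∈ K) (hvx : v ≠ x)
    (hux : u ≠ x) (h₁ : s(v, x) ∉ D₂ ∪ insert e (insert f K)) (h₂ : s(u, x) ∉ D₂ ∪ insert e (insert f K))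
    (h :
    (∑ G ∈ (insert s(u, x) D₂).powerset.filter (fun G =>
        (fromEdgeSet ((G ∪ (insert e (insert f (K))) : Finset (Sym2 V)) : Set (Sym2 V))).IsAcyclic), ∏ y ∈ G, Function.update w s(u, x) (w s(u, x) + w s(v, x)) y) *
      (∑ G ∈ (insert s(u, x) D₂).powerset.filter (fun G =>
        (fromEdgeSet ((G ∪ (K) : Finset (Sym2 V)) : Set (Sym2 V))).IsAcyclic), ∏ y ∈ G, Function.update w s(u, x) (w s(u, x) + w s(v, x)) y) ≤
    (∑ G ∈ (insert s(u, x) D₂).powerset.filter (fun G =>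
        (fromEdgeSet ((G ∪ (insert e (K)) : Finset (Sym2 V)) : Set (Sym2 V))).IsAcyclic), ∏ y ∈ G, Function.update w s(u, x) (w s(u, x) + w s(v, x)) y) *
      (∑ G ∈ (insert s(u, x) D₂).powerset.filter (fun G =>
        (fromEdgeSet ((G ∪ (insert f (K)) : Finset (Sym2 V)) : Set (Sym2 V))).IsAcyclic), ∏ y ∈ G, Function.update w s(u, x) (w s(u, x) + w s(v, x)) y)) :
    (∑ G ∈ (insert s(v, x) (insert s(u, x) D₂)).powerset.filter (fun G =>
        (fromEdgeSet ((G ∪ (insert e (insert f (K))) : Finset (Sym2 V)) : Set (Sym2 V))).IsAcyclic), ∏ y ∈ G, w y) *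
      (∑ G ∈ (insert s(v, x) (insert s(u, x) D₂)).powerset.filter (fun G =>
        (fromEdgeSet ((G ∪ (K) : Finset (Sym2 V)) : Set (Sym2 V))).IsAcyclic), ∏ y ∈ G, w y) ≤
    (∑ G ∈ (insert s(v, x) (insert s(u, x) D₂)).powerset.filter (fun G =>
        (fromEdgeSet ((G ∪ (insert e (K)) : Finset (Sym2 V)) : Set (Sym2 V))).IsAcyclic), ∏ y ∈ G, w y) *
      (∑ G ∈ (insert s(v, x) (insert s(u, x) D₂)).powerset.filter (fun G =>
        (fromEdgeSet ((G ∪ (insert f (K)) : Finset (Sym2 V)) : Set (Sym2 V))).IsAcyclic), ∏ y ∈ G, w y) := by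
  have key : ∀ X : Finset (Sym2 V), X ⊆ insert e (insert f K) → K ⊆ X →
      (∑ G ∈ (insert s(v, x) (insert s(u, x) D₂)).powerset.filter (fun G =>
        (fromEdgeSet ((G ∪ X : Finset (Sym2 V)) : Set (Sym2 V))).IsAcyclic), ∏ y ∈ G, w y) =
      (∑ G ∈ (insert s(u, x) D₂).powerset.filter (fun G =>
        (fromEdgeSet ((G ∪ X : Finset (Sym2 V)) : Set (Sym2 V))).IsAcyclic),
        ∏ y ∈ G, Function.update w s(u, x) (w s(u, x) + w s(v, x)) y) := by
    intro X hX hKX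
    have hsub : D₂ ∪ X ⊆ D₂ ∪ insert e (insert f K) := Finset.union_subset_union subset_rfl hX
    exact forestsW_free_parallel w D₂ X (fun z hz => hDK z (hsub hz)) (hKX huv) hvx hux
      (fun hh => h₁ (hsub hh)) (fun hh => h₂ (hsub hh))
  rw [key _ subset_rfl (by intro z hz; simp [hz]),
    key K ((Finset.subset_insert _ _).trans (Finset.subset_insert _ _)) subset_rfl,
    key (insert e K) (Finset.insert_subset_insert e (Finset.subset_insert _ _)) (Finset.subset_insert _ _),
    key (insert f K) (Finset.subset_insert _ _) (Finset.subset_insert _ _)]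
  exact h

/-- **Re-routing the Rayleigh edge `e = vx` through the pinned edge `uv`.** With `uv ∈ K`,
`vx, ux ∉ D ∪ K ∪ {f}` (`x ≠ u, v`): `(R)(D;K;ux,f)` gives `(R)(D;K;vx,f)`.
[elementary; `forestsW_pin_reroute`] -/
theorem lsm_rayleigh_reroute (w : Sym2 V → ℝ) (D K : Finset (Sym2 V)) (f : Sym2 V) {u v x : V}
    (hDK : ∀ z ∈ D ∪ insert f K, ¬z.IsDiag) (huv : s(v, u) ∈ K) (hvx : v ≠ x) (hux : u ≠ x)
    (h₁ : s(v, x) ∉ D ∪ insert f K) (h₂ : s(u, x) ∉ D ∪ insert f K)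
    (h :
    (∑ G ∈ D.powerset.filter (fun G =>
        (fromEdgeSet ((G ∪ (insert s(u, x) (insert f (K))) : Finset (Sym2 V)) : Set (Sym2 V))).IsAcyclic), ∏ y ∈ G, w y) *
      (∑ G ∈ D.powerset.filter (fun G =>
        (fromEdgeSet ((G ∪ (K) : Finset (Sym2 V)) : Set (Sym2 V))).IsAcyclic), ∏ y ∈ G, w y) ≤
    (∑ G ∈ D.powerset.filter (fun G =>
        (fromEdgeSet ((G ∪ (insert s(u, x) (K)) : Finset (Sym2 V)) : Set (Sym2 V))).IsAcyclic), ∏ y ∈ G, w y) *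
      (∑ G ∈ D.powerset.filter (fun G =>
        (fromEdgeSet ((G ∪ (insert f (K)) : Finset (Sym2 V)) : Set (Sym2 V))).IsAcyclic), ∏ y ∈ G, w y)) :
    (∑ G ∈ D.powerset.filter (fun G =>
        (fromEdgeSet ((G ∪ (insert s(v, x) (insert f (K))) : Finset (Sym2 V)) : Set (Sym2 V))).IsAcyclic), ∏ y ∈ G, w y) *
      (∑ G ∈ D.powerset.filter (fun G =>
        (fromEdgeSet ((G ∪ (K) : Finset (Sym2 V)) : Set (Sym2 V))).IsAcyclic), ∏ y ∈ G, w y) ≤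
    (∑ G ∈ D.powerset.filter (fun G =>
        (fromEdgeSet ((G ∪ (insert s(v, x) (K)) : Finset (Sym2 V)) : Set (Sym2 V))).IsAcyclic), ∏ y ∈ G, w y) *
      (∑ G ∈ D.powerset.filter (fun G =>
        (fromEdgeSet ((G ∪ (insert f (K)) : Finset (Sym2 V)) : Set (Sym2 V))).IsAcyclic), ∏ y ∈ G, w y) := by
  have hDK₀ : ∀ z ∈ D ∪ K, ¬z.IsDiag := fun z hz => hDK z (by
    rcases Finset.mem_union.1 hz with hz | hz
    · exact Finset.mem_union_left _ hz
    · exact Finset.mem_union_right _ (Finset.mem_insert_of_mem hz))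
  have h₁' : s(v, x) ∉ D ∪ K := fun hh => h₁ (by
    rcases Finset.mem_union.1 hh with hh | hh
    · exact Finset.mem_union_left _ hh
    · exact Finset.mem_union_right _ (Finset.mem_insert_of_mem hh))
  have h₂' : s(u, x) ∉ D ∪ K := fun hh => h₂ (by
    rcases Finset.mem_union.1 hh with hh | hh
    · exact Finset.mem_union_left _ hh
    · exact Finset.mem_union_right _ (Finset.mem_insert_of_mem hh))
  rw [forestsW_pin_reroute w D (insert f K) hDK (Finset.mem_insert_of_mem huv) hvx hux h₁ h₂,
    forestsW_pin_reroute w D K hDK₀ huv hvx hux h₁' h₂']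
  exact h

/-- **The pinned edge `uv` alone at `v` is irrelevant.** If `v` meets no edge of
`D ∪ K₀ ∪ {e,f}` and `u ≠ v`: `(R)(D;K₀;e,f)` gives `(R)(D;K₀ ∪ uv;e,f)`.
[elementary; `forestsW_pin_pendant`] -/
theorem lsm_pin_pendant (w : Sym2 V → ℝ) (D K₀ : Finset (Sym2 V)) (e f : Sym2 V) {u v : V}
    (hDK : ∀ z ∈ D ∪ insert e (insert f K₀), ¬z.IsDiag)
    (hv : ∀ z ∈ D ∪ insert e (insert f K₀), v ∉ z) (huv : u ≠ v)
    (h :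
    (∑ G ∈ D.powerset.filter (fun G =>
        (fromEdgeSet ((G ∪ (insert e (insert f (K₀))) : Finset (Sym2 V)) : Set (Sym2 V))).IsAcyclic), ∏ y ∈ G, w y) *
      (∑ G ∈ D.powerset.filter (fun G =>
        (fromEdgeSet ((G ∪ (K₀) : Finset (Sym2 V)) : Set (Sym2 V))).IsAcyclic), ∏ y ∈ G, w y) ≤
    (∑ G ∈ D.powerset.filter (fun G =>
        (fromEdgeSet ((G ∪ (insert e (K₀)) : Finset (Sym2 V)) : Set (Sym2 V))).IsAcyclic), ∏ y ∈ G, w y) *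
      (∑ G ∈ D.powerset.filter (fun G =>
        (fromEdgeSet ((G ∪ (insert f (K₀)) : Finset (Sym2 V)) : Set (Sym2 V))).IsAcyclic), ∏ y ∈ G, w y)) :
    (∑ G ∈ D.powerset.filter (fun G =>
        (fromEdgeSet ((G ∪ (insert e (insert f (insert s(v, u) K₀))) : Finset (Sym2 V)) : Set (Sym2 V))).IsAcyclic), ∏ y ∈ G, w y) *
      (∑ G ∈ D.powerset.filter (fun G =>
        (fromEdgeSet ((G ∪ ((insert s(v, u) K₀)) : Finset (Sym2 V)) : Set (Sym2 V))).IsAcyclic), ∏ y ∈ G, w y) ≤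
    (∑ G ∈ D.powerset.filter (fun G =>
        (fromEdgeSet ((G ∪ (insert e (insert s(v, u) K₀)) : Finset (Sym2 V)) : Set (Sym2 V))).IsAcyclic), ∏ y ∈ G, w y) *
      (∑ G ∈ D.powerset.filter (fun G =>
        (fromEdgeSet ((G ∪ (insert f (insert s(v, u) K₀)) : Finset (Sym2 V)) : Set (Sym2 V))).IsAcyclic), ∏ y ∈ G, w y) := by
  have key : ∀ X : Finset (Sym2 V), X ⊆ insert e (insert f K₀) →
      (∑ G ∈ D.powerset.filter (fun G =>
        (fromEdgeSet ((G ∪ insert s(v, u) X : Finset (Sym2 V)) : Set (Sym2 V))).IsAcyclic), ∏ y ∈ G, w y) =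
      (∑ G ∈ D.powerset.filter (fun G =>
        (fromEdgeSet ((G ∪ X : Finset (Sym2 V)) : Set (Sym2 V))).IsAcyclic), ∏ y ∈ G, w y) := by
    intro X hX
    have hsub : D ∪ X ⊆ D ∪ insert e (insert f K₀) := Finset.union_subset_union subset_rfl hX
    exact forestsW_pin_pendant w D X (fun z hz => hDK z (hsub hz)) (fun z hz => hv z (hsub hz)) huv
  have e₁ : insert e (insert f (insert s(v, u) K₀)) = insert s(v, u) (insert e (insert f K₀)) := by
    ext z; simp only [Finset.mem_insert]; tauto
  have e₂ : insert e (insert s(v, u) K₀) = insert s(v, u) (insert e K₀) := Finset.insert_comm _ _ _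
  have e₃ : insert f (insert s(v, u) K₀) = insert s(v, u) (insert f K₀) := Finset.insert_comm _ _ _
  simp only [e₁]
  simp only [e₂, e₃]
  rw [key _ subset_rfl, key K₀ ((Finset.subset_insert _ _).trans (Finset.subset_insert _ _)),
    key (insert e K₀) (Finset.insert_subset_insert e (Finset.subset_insert _ _)),
    key (insert f K₀) (Finset.subset_insert _ _)]
  exact h

end Summit.CriticalPhenomena.PercolationContinuityZ3.Theorems.ForestRayleigh
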